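import Literature.NumberTheory.EllipticCurves.ShintaniKernelLevel256Law
import Literature.NumberTheory.EllipticCurves.ShintaniThetaSumBound
import Literature.NumberTheory.EllipticCurves.HeckeOperatorsPeterssonProofs
import Literature.NumberTheory.EllipticCurves.ModularDegreeFormulaDomainProofs
import Mathlib.NumberTheory.ModularForms.Bounds
import HarnessLib

/-!
# Shintani's theta lift of a weight-`2` cusp form on `Γ₀(64)` against the twisted kernel `K_D`

[[cite: Shintani1975, §2 (2.1), Prop. 2.1, Thm. 2]] — for `φ ∈ S₂(Γ₀(64))` and the twisted
level-`64` kernel `K_D(w, z)` (`ShintaniKernelPoisson`, `D` odd square-free) we DEFINE the lift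
`Φ_D(z) = ∫_{Γ₀(64)∖ℍ} φ(w) K_D(w, z) dμ(w)` (`shintaniLift`, the integral over the tree's
fundamental domain `⋃_q g_q⁻¹𝒟ᵒ` of `Γ₀(64)`, `ModularDegreeFormulaDomainProofs`) and PROVE:

* `liftIntegrand_smul` — the integrand `φ(w) K_D(w,z)` is `Γ₀(64)`-invariant in `w` (`φ` has weight
  `2`, `w ↦ K_D(w,z)` weight `-2`: `genKernel_sl_smul`, `invWeight_cD`);
* `isThetaAutomorphic_shintaniLift` — **`Φ_D` satisfies the `θ`-multiplier law of weight `3/2` on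
  `Γ₀(256)`** (trivial character), by the level-`256` law of `K_D` (`isThetaAutomorphic_kerD`,
  `ShintaniKernelLevel256Law`) under the integral sign;
* `integrableOn_liftIntegrand` — **absolute convergence**: on each piece `g_q⁻¹𝒟ᵒ`, after the
  measure-preserving substitution `w = g_q⁻¹σ`, `‖φ(g⁻¹σ)‖ ≤ B‖j‖²e^{-c Im σ}` (every translate of a
  cusp form decays: Mathlib's `CuspForm.translate`, `ModularFormClass.exp_decay_atImInfty'`,
  `CuspFormClass.exists_bound`) and `‖K_D(g⁻¹σ, z)‖ ≤ √(Im z)‖j‖⁻² C (Im σ)²` (the uniform theta-sum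
  bound `ShintaniThetaSumBound` after moving the lattice by the integer matrix `g⁻¹`, `intAct`), a
  bounded product on the finite-volume `𝒟ᵒ`;
* `measurable_kerD` (limit of continuous partial sums), `continuous_shintaniFn_left`.

NOT here: holomorphy of `Φ_D` and the cusp conditions (they follow from the unfolded Fourier
expansion, sequel), and the unfolding itself.  Everything is proved; the definitions are
`liftIntegrand`, `reps`/`liftDomain` (the domain), `shintaniLift`, `intAct`.
-/

noncomputable section

open Complex Real MeasureTheory Filter Asymptotics
open scoped MatrixGroups ModularForm Modular Topology Pointwise

namespace Literature.NumberTheory.EllipticCurves.Shintani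

open UpperHalfPlane hiding I
open CongruenceSubgroup ModularGroup
open Literature.NumberTheory.EllipticCurves.ModularForms

/-! ### Cusp forms: decay of all translates -/

section CuspDecay

variable {Γ : Subgroup (GL (Fin 2) ℝ)} [Γ.IsArithmetic]

/-- A cusp form of weight `2` satisfies `‖f τ‖ · Im τ ≤ C` on `ℍ`. [folklore] -/
theorem exists_norm_mul_im_le (f : CuspForm Γ 2) : ∃ C, 0 ≤ C ∧ ∀ τ : ℍ, ‖f τ‖ * τ.im ≤ C := by
  obtain ⟨C, hC⟩ := CuspFormClass.exists_bound (k := 2) f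
  refine ⟨max C 0, le_max_right _ _, fun τ ↦ ?_⟩
  have h := hC τ
  have hτ : 0 < τ.im := τ.im_pos
  rw [show ((2 : ℤ) : ℝ) / 2 = 1 by norm_num, Real.rpow_one] at h
  calc ‖f τ‖ * τ.im ≤ C / τ.im * τ.im := by gcongr
    _ = C := by field_simp
    _ ≤ max C 0 := le_max_left _ _

/-- `‖denom(a, τ)‖² = normSq` and `Im(a τ) = Im τ/‖denom‖²`. [folklore] -/
theorem norm_denom_sq_eq (a : SL(2, ℤ)) (τ : ℍ) :
    ‖denom (a : GL (Fin 2) ℝ) τ‖ ^ 2 = Complex.normSq (denom (a : GL (Fin 2) ℝ) τ) :=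
  (Complex.normSq_eq_norm_sq _).symm

/-- **Exponential decay of every translate of a weight-`2` cusp form high in the strip**:
`‖f(aτ)‖ ≤ B ‖cτ + d‖² e^{-c Im τ}` for `Im τ ≥ 1/2`, for every `a ∈ SL₂(ℤ)`. [folklore] -/
theorem exists_decay_translate (f : CuspForm Γ 2) (a : SL(2, ℤ)) :
    ∃ B c : ℝ, 0 < c ∧ 0 ≤ B ∧ ∀ τ : ℍ, 1 / 2 ≤ τ.im →
      ‖f (a • τ)‖ ≤ B * ‖denom (a : GL (Fin 2) ℝ) τ‖ ^ 2 * Real.exp (-c * τ.im) := by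
  -- the translate `f ∣[2] a` is a cusp form for the conjugate (arithmetic) group
  haveI hA : ((ConjAct.toConjAct (a : GL (Fin 2) ℝ)⁻¹) • Γ).IsArithmetic := by
    simpa [(show Rat.castHom ℝ = algebraMap ℚ ℝ by rfl), map_inv, Matrix.SpecialLinearGroup.map_mapGL]
      using! Subgroup.IsArithmetic.conj Γ (Matrix.SpecialLinearGroup.mapGL ℚ a)⁻¹
  set g := CuspForm.translate f (a : GL (Fin 2) ℝ) with hg
  obtain ⟨c, hc, hO⟩ := ModularFormClass.exp_decay_atImInfty' g (CuspFormClass.zero_at_infty g)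
  -- an explicit bound far up
  obtain ⟨B₁, hB₁, hW⟩ := hO.exists_pos
  rw [IsBigOWith] at hW
  obtain ⟨A, hA'⟩ := (atImInfty_mem _).mp hW
  -- the global bound `‖f‖ Im ≤ C`
  obtain ⟨C, hC0, hC⟩ := exists_norm_mul_im_le f
  have hgval : ∀ τ : ℍ, g τ = f (a • τ) * (denom (a : GL (Fin 2) ℝ) τ) ^ (-(2 : ℤ)) := by
    intro τ
    have := congrFun (CuspForm.coe_translate (k := 2) f a) τ
    rw [ModularForm.SL_slash_apply] at this
    exact this
  set A' : ℝ := max A (1 / 2) with hA'def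
  refine ⟨max B₁ (2 * C * Real.exp (c * A')), c, hc, le_max_of_le_left hB₁.le, fun τ hτ ↦ ?_⟩
  have hd0 : denom (a : GL (Fin 2) ℝ) τ ≠ 0 := denom_ne_zero _ _
  have hdn : 0 < ‖denom (a : GL (Fin 2) ℝ) τ‖ := norm_pos_iff.mpr hd0
  -- `‖f(aτ)‖ = ‖g τ‖ ‖denom‖²`
  have hfg : ‖f (a • τ)‖ = ‖g τ‖ * ‖denom (a : GL (Fin 2) ℝ) τ‖ ^ 2 := by
    rw [hgval, norm_mul, norm_zpow, _root_.zpow_neg, mul_assoc, ← zpow_natCast,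
      show ((2 : ℕ) : ℤ) = 2 from rfl, inv_mul_cancel₀ (zpow_ne_zero _ hdn.ne'), mul_one]
  -- `‖g τ‖ ≤ max(…) e^{-c Im τ}`
  have hgoal : ‖g τ‖ ≤ max B₁ (2 * C * Real.exp (c * A')) * Real.exp (-c * τ.im) := by
    rcases le_or_gt A' τ.im with hτA | hτA
    · -- far up: the `O`-bound
      have h1 := hA' τ (le_trans (le_max_left _ _) hτA)
      simp only [Set.mem_setOf_eq] at h1
      rw [Real.norm_of_nonneg (Real.exp_pos _).le] at h1
      exact h1.trans (mul_le_mul_of_nonneg_right (le_max_left _ _) (Real.exp_pos _).le)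
    · -- `1/2 ≤ Im τ ≤ A'`: `‖g τ‖ = ‖f(aτ)‖/‖d‖² ≤ C/Im τ ≤ 2C`
      have him : (a • τ).im = τ.im / Complex.normSq (denom (a : GL (Fin 2) ℝ) τ) :=
        ModularGroup.im_smul_eq_div_normSq a τ
      have hgC : ‖g τ‖ ≤ 2 * C := by
        have h1 := hC (a • τ)
        rw [him, ← norm_denom_sq_eq, hfg] at h1
        -- `h1 : ‖g τ‖ ‖d‖² (Im τ / ‖d‖²) ≤ C`
        have h2 : ‖g τ‖ * τ.im ≤ C := by
          have : ‖g τ‖ * ‖denom (a : GL (Fin 2) ℝ) τ‖ ^ 2 *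
              (τ.im / ‖denom (a : GL (Fin 2) ℝ) τ‖ ^ 2) = ‖g τ‖ * τ.im := by
            field_simp
          linarith [this]
        have h3 : ‖g τ‖ * (1 / 2) ≤ ‖g τ‖ * τ.im := mul_le_mul_of_nonneg_left hτ (norm_nonneg _)
        linarith
      have hexp : 1 ≤ Real.exp (c * A') * Real.exp (-c * τ.im) := by
        rw [← Real.exp_add]
        exact Real.one_le_exp (by nlinarith [hτA.le])
      calc ‖g τ‖ ≤ 2 * C := hgC
        _ ≤ 2 * C * (Real.exp (c * A') * Real.exp (-c * τ.im)) :=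
            le_mul_of_one_le_right (by positivity) hexp
        _ = 2 * C * Real.exp (c * A') * Real.exp (-c * τ.im) := by ring
        _ ≤ max B₁ (2 * C * Real.exp (c * A')) * Real.exp (-c * τ.im) := by
            gcongr; exact le_max_right _ _
  rw [hfg]
  calc ‖g τ‖ * ‖denom (a : GL (Fin 2) ℝ) τ‖ ^ 2
      ≤ (max B₁ (2 * C * Real.exp (c * A')) * Real.exp (-c * τ.im)) * ‖denom (a : GL (Fin 2) ℝ) τ‖ ^ 2 :=
        mul_le_mul_of_nonneg_right hgoal (sq_nonneg _)
    _ = _ := by ring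

end CuspDecay

/-! ### The kernel at a translate: `‖K_D(w, aτ; z)‖ ≤ √(Im z) ‖cτ+d‖⁻² C (Im τ)²` -/

section KernelBound

variable (D : ℕ) [NeZero D]

omit [NeZero D] in
/-- `|c_D(k)| ≤ 1`. [folklore] -/
theorem norm_cD_le_one (k : Fin 3 → ℤ) : ‖cD D k‖ ≤ 1 := by
  unfold cD
  split_ifs
  · rw [Complex.norm_intCast]
    exact_mod_cast abs_genusWt_le D _
  · simp

/-- The integer matrix action on `ℤ³` whose image under `vec` is `actV a (ι♮ k)`. [folklore] -/
def intAct (a : SL(2, ℤ)) (k : Fin 3 → ℤ) : Fin 3 → ℤ :=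
  ![64 * k 0 * (a 0 0) ^ 2 + k 1 * (a 0 0) * (a 1 0) + k 2 * (a 1 0) ^ 2,
    2 * (64 * k 0) * (a 0 0) * (a 0 1) + k 1 * (a 0 0 * a 1 1 + a 0 1 * a 1 0) + 2 * k 2 * (a 1 0) * (a 1 1),
    64 * k 0 * (a 0 1) ^ 2 + k 1 * (a 0 1) * (a 1 1) + k 2 * (a 1 1) ^ 2]

/-- `vec (intAct a k) = actV a (ι♮ k)`. [folklore] -/
theorem vec_intAct (a : SL(2, ℤ)) (k : Fin 3 → ℤ) :
    vec (intAct a k) = actV (a 0 0 : ℤ) (a 0 1 : ℤ) (a 1 0 : ℤ) (a 1 1 : ℤ) (latSharp k) := by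
  ext i
  fin_cases i <;> simp [vec, intAct, actV, latSharp]

/-- `intAct a` is injective (compose with the action of `a⁻¹` and read off `ι♮`). [folklore] -/
theorem intAct_injective (a : SL(2, ℤ)) : Function.Injective (intAct a) := by
  intro k l h
  have hv : actV (a 0 0 : ℤ) (a 0 1 : ℤ) (a 1 0 : ℤ) (a 1 1 : ℤ) (latSharp k) =
      actV (a 0 0 : ℤ) (a 0 1 : ℤ) (a 1 0 : ℤ) (a 1 1 : ℤ) (latSharp l) := by
    rw [← vec_intAct, ← vec_intAct, h]
  -- apply the inverse action
  have hdet : ((a 0 0 : ℤ) : ℝ) * (a 1 1 : ℤ) - (a 0 1 : ℤ) * (a 1 0 : ℤ) = 1 := by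
    exact_mod_cast Literature.NumberTheory.EllipticCurves.ModularForms.det_eq_one' a
  have hinv : ∀ x : V, actV (a 1 1 : ℤ) (-(a 0 1 : ℤ) : ℝ) (-(a 1 0 : ℤ) : ℝ) (a 0 0 : ℤ)
      (actV (a 0 0 : ℤ) (a 0 1 : ℤ) (a 1 0 : ℤ) (a 1 1 : ℤ) x) = x := by
    intro x
    rw [actV_actV]
    have e1 : ((a 0 0 : ℤ) : ℝ) * (a 1 1 : ℤ) + (a 0 1 : ℤ) * (-(a 1 0 : ℤ) : ℝ) = 1 := by
      linear_combination hdet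
    have e2 : ((a 0 0 : ℤ) : ℝ) * (-(a 0 1 : ℤ) : ℝ) + (a 0 1 : ℤ) * ((a 0 0 : ℤ) : ℝ) = 0 := by ring
    have e3 : ((a 1 0 : ℤ) : ℝ) * (a 1 1 : ℤ) + (a 1 1 : ℤ) * (-(a 1 0 : ℤ) : ℝ) = 0 := by ring
    have e4 : ((a 1 0 : ℤ) : ℝ) * (-(a 0 1 : ℤ) : ℝ) + (a 1 1 : ℤ) * ((a 0 0 : ℤ) : ℝ) = 1 := by
      linear_combination hdet
    rw [e1, e2, e3, e4, actV_id]
  have := congrArg (actV (a 1 1 : ℤ) (-(a 0 1 : ℤ) : ℝ) (-(a 1 0 : ℤ) : ℝ) (a 0 0 : ℤ)) hv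
  rw [hinv, hinv] at this
  exact latSharp_injective this

/-- **The kernel series at a translate is dominated by the full theta sum at `τ`**:
`∑_k ‖f_{aτ,Z}(ι♮ k)‖ ≤ ‖cτ+d‖⁻² ∑_{x ∈ ℤ³} ‖x(τ,1)‖ e^{-2π Im Z · majorant_τ(x)}`. [folklore] -/
theorem tsum_norm_shintaniFn_smul_le (a : SL(2, ℤ)) (τ Z : ℍ) :
    ∑' k : Fin 3 → ℤ, ‖shintaniFn (a • τ) Z (latSharp k)‖ ≤
      (‖denom (a : GL (Fin 2) ℝ) τ‖ ^ 2)⁻¹ *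
        ∑' m : Fin 3 → ℤ, ‖formEval (vec m) τ‖ * Real.exp (-(2 * π * Z.im) * majorant τ (vec m)) := by
  have hd0 : denom (a : GL (Fin 2) ℝ) τ ≠ 0 := denom_ne_zero _ _
  have hdn : 0 < ‖denom (a : GL (Fin 2) ℝ) τ‖ := norm_pos_iff.mpr hd0
  have hden : (((a 1 0 : ℤ) : ℂ) * τ + ((a 1 1 : ℤ) : ℂ)) = denom (a : GL (Fin 2) ℝ) τ := by
    rw [ModularGroup.denom_apply]
  -- termwise: `‖f_{aτ}(ι♮ k)‖ = ‖f_τ(actV a (ι♮ k))‖ / ‖denom‖²`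
  set g : (Fin 3 → ℤ) → ℝ := fun m ↦ ‖formEval (vec m) τ‖ *
    Real.exp (-(2 * π * Z.im) * majorant τ (vec m)) with hgdef
  have hterm : ∀ k : Fin 3 → ℤ, ‖shintaniFn (a • τ) Z (latSharp k)‖ =
      (‖denom (a : GL (Fin 2) ℝ) τ‖ ^ 2)⁻¹ * g (intAct a k) := by
    intro k
    have h := shintaniFn_sl_smul a τ Z (latSharp k)
    rw [hden, ← vec_intAct] at h
    have h' : shintaniFn (a • τ) Z (latSharp k) =
        shintaniFn τ Z (vec (intAct a k)) / (denom (a : GL (Fin 2) ℝ) τ) ^ 2 := by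
      rw [eq_div_iff (pow_ne_zero _ hd0), mul_comm]
      exact h.symm
    rw [h', norm_div, norm_pow, norm_shintaniFn, hgdef]
    dsimp only
    rw [show -(2 * π * Z.im * majorant τ (vec (intAct a k))) =
      -(2 * π * Z.im) * majorant τ (vec (intAct a k)) by ring]
    field_simp
  have ha : 0 < 2 * π * Z.im := by have := Z.im_pos; positivity
  have hS : Summable g := (tsum_norm_formEval_mul_exp_le ha τ.im_pos τ le_rfl).1
  calc ∑' k : Fin 3 → ℤ, ‖shintaniFn (a • τ) Z (latSharp k)‖
      = ∑' k : Fin 3 → ℤ, (‖denom (a : GL (Fin 2) ℝ) τ‖ ^ 2)⁻¹ * g (intAct a k) := tsum_congr hterm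
    _ = (‖denom (a : GL (Fin 2) ℝ) τ‖ ^ 2)⁻¹ * ∑' k : Fin 3 → ℤ, g (intAct a k) := tsum_mul_left
    _ ≤ (‖denom (a : GL (Fin 2) ℝ) τ‖ ^ 2)⁻¹ * ∑' m : Fin 3 → ℤ, g m := by
        refine mul_le_mul_of_nonneg_left ?_ (by positivity)
        exact tsum_comp_le_tsum_of_inj hS (fun m ↦ by positivity) (intAct_injective a)

/-- **The kernel at a translate**: for `Im τ ≥ 1/2`,
`‖K_D(aτ; z)‖ ≤ √(Im z) ‖cτ+d‖⁻² C_z (Im τ)²` with `C_z` the constant of `ShintaniThetaSumBound`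
at `a = 2π Im z/(256D)`, `v₀ = 1/2`. [cite: Shintani1975, §2] -/
theorem norm_kerD_smul_le (a : SL(2, ℤ)) (z τ : ℍ) (hτ : 1 / 2 ≤ τ.im) :
    ‖kerD D (a • τ) z‖ ≤ Real.sqrt z.im * (‖denom (a : GL (Fin 2) ℝ) τ‖ ^ 2)⁻¹ *
      (thetaZ (2 * ((2 * π * (mulPos (1 / (256 * D)) (scaleD_pos D) z).im) / 2) * (1 / 2) ^ 2) *
        thetaZ ((2 * π * (mulPos (1 / (256 * D)) (scaleD_pos D) z).im) / 2) *
        thetaZ (2 * ((2 * π * (mulPos (1 / (256 * D)) (scaleD_pos D) z).im) / 2) / (1 / 2) ^ 2) /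
        ((1 / 2) * Real.sqrt (2 * (2 * π * (mulPos (1 / (256 * D)) (scaleD_pos D) z).im))) * τ.im ^ 2) := by
  set Z : ℍ := mulPos (1 / (256 * D)) (scaleD_pos D) z with hZ
  have ha : 0 < 2 * π * Z.im := by have := Z.im_pos; positivity
  obtain ⟨hS, hB⟩ := tsum_norm_formEval_mul_exp_le ha (half_pos one_pos) τ hτ
  unfold kerD genKernel
  rw [norm_mul, Complex.norm_real, Real.norm_of_nonneg (Real.sqrt_nonneg _), mul_assoc]
  refine mul_le_mul_of_nonneg_left ?_ (Real.sqrt_nonneg _)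
  -- `‖Σ c_D f‖ ≤ Σ ‖f‖ ≤ ‖d‖⁻² Σ_x … ≤ ‖d‖⁻² C (Im τ)²`
  have hs1 : Summable fun k : Fin 3 → ℤ ↦ ‖shintaniFn (a • τ) Z (latSharp k)‖ := by
    have := summable_term (c := fun _ ↦ (1 : ℂ)) ⟨1, fun _ ↦ by simp⟩ (a • τ) Z
    simpa using this.norm
  calc ‖∑' k : Fin 3 → ℤ, cD D k * shintaniFn (a • τ) Z (latSharp k)‖
      ≤ ∑' k : Fin 3 → ℤ, ‖cD D k * shintaniFn (a • τ) Z (latSharp k)‖ := norm_tsum_le_tsum_norm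
          ((summable_term (bddWeight_cD D) (a • τ) Z).norm)
    _ ≤ ∑' k : Fin 3 → ℤ, ‖shintaniFn (a • τ) Z (latSharp k)‖ := by
        refine Summable.tsum_le_tsum (fun k ↦ ?_) ((summable_term (bddWeight_cD D) (a • τ) Z).norm) hs1
        rw [norm_mul]
        exact mul_le_of_le_one_left (norm_nonneg _) (norm_cD_le_one D k)
    _ ≤ _ := tsum_norm_shintaniFn_smul_le a τ Z
    _ ≤ _ := by
        refine mul_le_mul_of_nonneg_left hB (by positivity)

end KernelBound

/-! ### Measurability of the kernel in `w` -/

section Measurability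

variable (D : ℕ) [NeZero D]

/-- `w ↦ f_{w,Z}(x)` is continuous. [folklore] -/
theorem continuous_shintaniFn_left (Z : ℍ) (x : V) : Continuous fun w : ℍ ↦ shintaniFn w Z x := by
  have hcoe : Continuous (UpperHalfPlane.coe : ℍ → ℂ) := continuous_coe
  have hpw : Continuous fun w : ℍ ↦ pw w x := by
    unfold pw
    refine Continuous.div ?_ UpperHalfPlane.continuous_im (fun w ↦ w.im_pos.ne')
    have h1 : Continuous fun w : ℍ ↦ Complex.normSq (w : ℂ) := Complex.continuous_normSq.comp hcoe
    have h2 : Continuous fun w : ℍ ↦ w.re := UpperHalfPlane.continuous_re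
    fun_prop
  have hmaj : Continuous fun w : ℍ ↦ majorant w x := by
    unfold majorant
    fun_prop
  have hform : Continuous fun w : ℍ ↦ formEval x w := by
    unfold formEval
    fun_prop
  unfold shintaniFn
  have h3 : Continuous fun w : ℍ ↦ ((majorant w x : ℝ) : ℂ) := Complex.continuous_ofReal.comp hmaj
  fun_prop

/-- `w ↦ K_D(w, z)` is measurable (limit of the continuous partial sums). [folklore] -/
theorem measurable_kerD (z : ℍ) : Measurable fun w : ℍ ↦ kerD D w z := by
  set Z : ℍ := mulPos (1 / (256 * D)) (scaleD_pos D) z with hZ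
  have hcont : ∀ k : Fin 3 → ℤ, Continuous fun w : ℍ ↦ cD D k * shintaniFn w Z (latSharp k) :=
    fun k ↦ continuous_const.mul (continuous_shintaniFn_left Z _)
  have hlim : Tendsto (fun s : Finset (Fin 3 → ℤ) ↦ fun w : ℍ ↦
      ∑ k ∈ s, cD D k * shintaniFn w Z (latSharp k)) atTop
      (𝓝 fun w ↦ ∑' k : Fin 3 → ℤ, cD D k * shintaniFn w Z (latSharp k)) :=
    tendsto_pi_nhds.mpr fun w ↦ (summable_term (bddWeight_cD D) w Z).hasSum
  have hm : Measurable fun w : ℍ ↦ ∑' k : Fin 3 → ℤ, cD D k * shintaniFn w Z (latSharp k) :=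
    measurable_of_tendsto_metrizable' atTop
      (fun s ↦ (continuous_finsetSum s fun k _ ↦ hcont k).measurable) hlim
  have hsqrt : Measurable fun w : ℍ ↦ ((Real.sqrt z.im : ℝ) : ℂ) := measurable_const
  unfold kerD genKernel
  exact hsqrt.mul hm

end Measurability

/-! ### The lift: domain, definition, invariance, integrability, automorphy -/

section Lift

variable (D : ℕ) [NeZero D]

/-- The integrand `h_z(w) = φ(w) K_D(w, z)` of the theta lift. [cite: Shintani1975, §2 (2.1)] -/
def liftIntegrand (φ : ℍ → ℂ) (z w : ℍ) : ℂ := φ w * kerD D w z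

/-- **`Γ₀(64)`-invariance of the integrand** (`D` odd): `φ` has weight `2`, `w ↦ K_D(w,z)` weight `-2`.
[cite: Shintani1975, §2 (2.1), (2.12)] -/
theorem liftIntegrand_smul (hD : Odd D) (f : CuspForm (Gamma0 64) 2) (z : ℍ) {γ : SL(2, ℤ)}
    (hγ : γ ∈ Gamma0 64) (w : ℍ) :
    liftIntegrand D f z (γ • w) = liftIntegrand D f z w := by
  unfold liftIntegrand
  have hmem : (γ : GL (Fin 2) ℝ) ∈ (Gamma0 64 : Subgroup (GL (Fin 2) ℝ)) := ⟨γ, hγ, rfl⟩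
  have h1 : f (γ • w) = (denom (γ : GL (Fin 2) ℝ) w) ^ (2 : ℤ) * f w := by
    have := SlashInvariantForm.slash_action_eqn'' f hmem w
    simpa using this
  have h64 : (64 : ℤ) ∣ γ 1 0 := by
    have h0 : ((γ 1 0 : ℤ) : ZMod 64) = 0 := Gamma0_mem.mp hγ
    exact (ZMod.intCast_zmod_eq_zero_iff_dvd _ 64).mp h0
  have h2 := genKernel_sl_smul (invWeight_cD hD) (1 / (256 * D)) (scaleD_pos D) γ h64 w z
  rw [ModularGroup.denom_apply] at h1
  unfold kerD
  rw [h1, zpow_ofNat]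
  linear_combination (f w) * h2

/-- A system of representatives of `SL₂(ℤ)/Γ₀(64)` in `SL₂(ℤ)` (the tree's `exists_mapGL_eq_out`).
[folklore] -/
def reps : (↥𝒮ℒ ⧸ (Gamma0 64 : Subgroup (GL (Fin 2) ℝ)).subgroupOf 𝒮ℒ) → SL(2, ℤ) :=
  Classical.choose (exists_mapGL_eq_out (N := 64))

/-- The defining property of `reps`. [folklore] -/
theorem reps_spec : ∀ q, (Matrix.SpecialLinearGroup.mapGL ℝ (reps q) : GL (Fin 2) ℝ) =
    ((q.out : ↥𝒮ℒ) : GL (Fin 2) ℝ) :=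
  Classical.choose_spec (exists_mapGL_eq_out (N := 64))

/-- The fundamental domain `F = ⋃_q g_q⁻¹ 𝒟ᵒ` of `Γ₀(64)` used for the lift (the tree's domain of
`ModularDegreeFormulaDomainProofs` / `Gamma0RankinSelbergUnfolding`). [folklore] -/
def liftDomain : Set ℍ := ⋃ q, {τ : ℍ | reps q • τ ∈ 𝒟ᵒ}

/-- `liftDomain` is measurable (a finite union of open sets). [folklore] -/
theorem measurableSet_liftDomain : MeasurableSet liftDomain := by
  haveI := Fintype.ofFinite (↥𝒮ℒ ⧸ (Gamma0 64 : Subgroup (GL (Fin 2) ℝ)).subgroupOf 𝒮ℒ)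
  exact MeasurableSet.iUnion fun q ↦ (isOpen_setOf_smul_mem_fdo (reps q)).measurableSet

/-- **Shintani's theta lift** of `φ` against the twisted kernel `K_D`:
`Φ_D(z) = ∫_{Γ₀(64)∖ℍ} φ(w) K_D(w, z) dμ(w)` (`dμ = du dv/v²`, integral over the fundamental domain
`liftDomain`).  Weight `3/2`, level `256` in `z` (below). [cite: Shintani1975, §2 (2.1), Thm. 2] -/
def shintaniLift (φ : ℍ → ℂ) (z : ℍ) : ℂ := ∫ w in liftDomain, φ w * kerD D w z

/-- **The lift is `θ`-automorphic of weight `3/2` on `Γ₀(256)`** (for `D` odd square-free), by the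
level-`256` law of `K_D` under the integral sign. [cite: Shintani1975, §2 Thm. 2] -/
theorem isThetaAutomorphic_shintaniLift (hsq : Squarefree D) (hodd : Odd D) (φ : ℍ → ℂ) :
    IsThetaAutomorphic 3 256 1 (shintaniLift D φ) := by
  intro γ hγ z
  unfold shintaniLift
  rw [← integral_mul_const, ← integral_const_mul]
  congr 1
  funext w
  have hK := isThetaAutomorphic_kerD D hsq hodd w γ hγ z
  simp only at hK
  linear_combination (φ w) * hK

/-- `v² e^{-cv} ≤ 4/c²` for `v ≥ 0`, `c > 0`. [folklore] -/
theorem sq_mul_exp_neg_le {c : ℝ} (hc : 0 < c) {v : ℝ} (hv : 0 ≤ v) :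
    v ^ 2 * Real.exp (-c * v) ≤ 4 / c ^ 2 := by
  have h1 : 1 + c * v / 2 ≤ Real.exp (c * v / 2) := by linarith [Real.add_one_le_exp (c * v / 2)]
  have h2 : (c * v / 2) ^ 2 ≤ Real.exp (c * v) := by
    have := pow_le_pow_left₀ (by positivity) h1 2
    rw [← Real.exp_nat_mul] at this
    push_cast at this
    rw [show (2 : ℝ) * (c * v / 2) = c * v by ring] at this
    nlinarith [sq_nonneg (c * v / 2)]
  rw [show -c * v = -(c * v) by ring, Real.exp_neg, ← div_eq_mul_inv,
    div_le_div_iff₀ (Real.exp_pos _) (by positivity)]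
  nlinarith [h2]

/-- **Integrability on a translate of the open fundamental domain**: for every `s ∈ SL₂(ℤ)` the
integrand is integrable on `{τ | sτ ∈ 𝒟ᵒ}` (move to `𝒟ᵒ` by the measure-preserving `τ ↦ sτ`; there
`‖φ(s⁻¹σ)‖ ≤ B‖j‖²e^{-c Im σ}` and `‖K_D(s⁻¹σ, z)‖ ≤ √(Im z)‖j‖⁻² C (Im σ)²`, a bounded product).
[cite: Shintani1975, §2, Prop. 2.1] -/
theorem integrableOn_liftIntegrand_smul_fdo (f : CuspForm (Gamma0 64) 2) (z : ℍ) (s : SL(2, ℤ)) :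
    IntegrableOn (liftIntegrand D f z) {τ : ℍ | s • τ ∈ 𝒟ᵒ} := by
  set sG : GL (Fin 2) ℝ := (s : GL (Fin 2) ℝ) with hsG
  have hmp : MeasurePreserving (fun τ : ℍ ↦ sG • τ) volume volume := measurePreserving_smul _ _
  have hme : MeasurableEmbedding (fun τ : ℍ ↦ sG • τ) :=
    (MeasurableEquiv.smul sG).measurableEmbedding
  have hset : {τ : ℍ | s • τ ∈ 𝒟ᵒ} = (fun τ : ℍ ↦ sG • τ) ⁻¹' 𝒟ᵒ := by
    ext τ; simp [hsG]
  have hfun : liftIntegrand D f z =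
      (fun σ ↦ liftIntegrand D f z (sG⁻¹ • σ)) ∘ (fun τ : ℍ ↦ sG • τ) := by
    funext τ; simp
  rw [hset, hfun, hmp.integrableOn_comp_preimage hme]
  -- the translate by `a = s⁻¹`
  set a : SL(2, ℤ) := s⁻¹ with ha
  have haG : ∀ σ : ℍ, sG⁻¹ • σ = a • σ := by
    intro σ
    simp [ha, hsG, ModularGroup.sl_moeb, map_inv]
  simp_rw [haG]
  -- bounds
  obtain ⟨B, c, hc, hB0, hB⟩ := exists_decay_translate f a
  set Cz : ℝ := thetaZ (2 * ((2 * π * (mulPos (1 / (256 * D)) (scaleD_pos D) z).im) / 2) * (1 / 2) ^ 2) *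
      thetaZ ((2 * π * (mulPos (1 / (256 * D)) (scaleD_pos D) z).im) / 2) *
      thetaZ (2 * ((2 * π * (mulPos (1 / (256 * D)) (scaleD_pos D) z).im) / 2) / (1 / 2) ^ 2) /
      ((1 / 2) * Real.sqrt (2 * (2 * π * (mulPos (1 / (256 * D)) (scaleD_pos D) z).im))) with hCz
  have hCz0 : 0 ≤ Cz := by
    rw [hCz]
    have := (mulPos (1 / (256 * D)) (scaleD_pos D) z).im_pos
    refine div_nonneg (mul_nonneg (mul_nonneg (thetaZ_nonneg _) (thetaZ_nonneg _)) (thetaZ_nonneg _)) ?_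
    positivity
  set M : ℝ := B * (Real.sqrt z.im * Cz) * (4 / c ^ 2) with hM
  refine Measure.integrableOn_of_bounded (M := M)
    ((measure_mono ModularGroup.fdo_subset_fd).trans_lt volume_fd_lt_top).ne ?_ ?_
  · -- measurability
    have hφ : Continuous fun σ : ℍ ↦ f (a • σ) :=
      (CuspFormClass.holo f).continuous.comp (continuous_sl2z_smul a)
    have hK : Measurable fun σ : ℍ ↦ kerD D (a • σ) z :=
      (measurable_kerD D z).comp (continuous_sl2z_smul a).measurable
    exact (hφ.measurable.mul hK).aestronglyMeasurable
  · rw [ae_restrict_iff' ModularGroup.isOpen_fdo.measurableSet]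
    refine ae_of_all _ fun σ hσ ↦ ?_
    have hσ2 : 1 / 2 ≤ σ.im :=
      ((mem_verticalStrip_iff _ _ _).mp (fd_subset_verticalStrip (ModularGroup.fdo_subset_fd hσ))).2
    have hd0 : denom (a : GL (Fin 2) ℝ) σ ≠ 0 := denom_ne_zero _ _
    have hdn : 0 < ‖denom (a : GL (Fin 2) ℝ) σ‖ := norm_pos_iff.mpr hd0
    unfold liftIntegrand
    rw [norm_mul]
    have h1 := hB σ hσ2
    have h2 := norm_kerD_smul_le D a z σ hσ2
    rw [← hCz] at h2
    have h3 := sq_mul_exp_neg_le hc σ.im_pos.le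
    calc ‖f (a • σ)‖ * ‖kerD D (a • σ) z‖
        ≤ (B * ‖denom (a : GL (Fin 2) ℝ) σ‖ ^ 2 * Real.exp (-c * σ.im)) *
          (Real.sqrt z.im * (‖denom (a : GL (Fin 2) ℝ) σ‖ ^ 2)⁻¹ * (Cz * σ.im ^ 2)) :=
          mul_le_mul h1 h2 (norm_nonneg _) (by positivity)
      _ = B * (Real.sqrt z.im * Cz) * (σ.im ^ 2 * Real.exp (-c * σ.im)) := by
          field_simp
      _ ≤ B * (Real.sqrt z.im * Cz) * (4 / c ^ 2) := by
          gcongr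
      _ = M := by rw [hM]

/-- **Integrability of the lift's integrand on the fundamental domain.** [cite: Shintani1975, §2, Prop. 2.1] -/
theorem integrableOn_liftIntegrand (f : CuspForm (Gamma0 64) 2) (z : ℍ) :
    IntegrableOn (liftIntegrand D f z) liftDomain := by
  haveI := Fintype.ofFinite (↥𝒮ℒ ⧸ (Gamma0 64 : Subgroup (GL (Fin 2) ℝ)).subgroupOf 𝒮ℒ)
  unfold liftDomain
  exact (integrableOn_finite_iUnion).mpr fun q ↦ integrableOn_liftIntegrand_smul_fdo D f z (reps q)

/-- The lift of a cusp form as the integral of `liftIntegrand`. [folklore] -/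
theorem shintaniLift_eq (φ : ℍ → ℂ) (z : ℍ) :
    shintaniLift D φ z = ∫ w in liftDomain, liftIntegrand D φ z w := rfl

end Lift

end Literature.NumberTheory.EllipticCurves.Shintani
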